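import Mathlib.Analysis.InnerProductSpace.PiL2
import Mathlib.Analysis.Convex.Extreme
import Mathlib.Analysis.Convex.Hull
import Mathlib.LinearAlgebra.Determinant
import Mathlib.Order.LiminfLimsup
import Mathlib.Topology.Algebra.InfiniteSum.Real
import Mathlib.Data.Set.Card
import Literature.MathematicalPhysics.StatisticalMechanics.WulffCrystalEmergence
import HarnessLib

/-!
# The homogenized surface energy density of a periodic lattice system: finite cell formula,
# crystallinity, and the Wulff set as the image of the periodic circulation polytope
# (Chambolle–Kreutz 2023)

Topic `Literature/MathematicalPhysics/StatisticalMechanics` (namespace = path, grouping sub-namespace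
`ChambolleKreutz2023` for the paper's vocabulary).  Source: A. Chambolle, L. Kreutz, *Crystallinity of
the homogenized energy density of periodic lattice systems*, Multiscale Model. Simul. **21** (2023)
34–79 = arXiv:2106.08111 [ChambolleKreutz2023] (held: `paper:arxiv-2106.08111`, the arXiv TeX text;
locators are the paper's numbered statements of §2 and the displayed equations of the proof of
Theorem 2.7 in §5).  Cross-ladder literature-typing layer (D-0088 (4)), cell `crystal3d-full`, seat
`littype-FC1-2`: this is the printed theorem behind the cell's certified Wulff constants of periodic
Barlow stackings (`|W_fcc| = 256`, `|W_σ| = 260 − 4m²`, the law `γ(σ)³ = 432 + 27λ(1−λ)` of the route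
`Summit.Ventures.Crystal3D.Theses.StickyWulffConstant`, crux `StackingLiminf`): the density `ϕ_𝓛` of
Cicalese–Kreutz–Leonardi 2023 (their (19)–(20), Proposition 2.1 quoting "[11, Prop. 2.6]") is the
`φ` of this paper, computed on ONE period cell, and its Wulff set is a polytope — the linear image of
the periodic circulation (flow) polytope of the bond graph.

## Source, as printed (arXiv TeX text, §2 and §5)

* §2.2: "(L1) (Discreteness) There exists `c > 0` such that for all `x ∈ 𝓛` there holds
  `dist(x, 𝓛∖{x}) ≥ c`.  (L2) (Periodicity) There exists `T ∈ ℕ` such that for all `z ∈ ℤ^d` there holds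
  `𝓛 + Tz = 𝓛`.  Note that the two assumptions (L1) and (L2) include multi-lattices, such as the
  hexagonal closed packing lattice in three dimensions, and Bravais lattices, such as `ℤ^d`, or the
  face-centered cubic lattice in three dimensions."  "`E(u, A) := Σ_{i ∈ 𝓛 ∩ A} Σ_{j ∈ 𝓛} c_{i,j} (u(i) − u(j))⁺`,
  where `u : 𝓛 → ℝ` and `A ∈ 𝓑(ℝ^d)` … we are considering interactions on the directed graph".
  "(H1) (Periodicity) `c_{i+Tz,j+Tz} = c_{i,j}` for all `i, j ∈ 𝓛`, `z ∈ ℤ^d`.  (H2) (Decay of Interactions)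
  For all `i ∈ 𝓛` there holds `Σ_{j∈𝓛} c_{i,j}|i − j| < +∞`.  (H3) (Finite Range Interactions) There
  exists `R > 1` such that `c_{i,j} = 0` for all `i, j ∈ 𝓛` such that `|i − j| ≥ R`."
* §2.1: "`Q_ρ := [−ρ/2, ρ/2)^d` the half open cube centred in `0` with side-length `ρ`.  For
  `ν ∈ 𝕊^{d−1}`, we set `Q^ν_ρ := R^ν Q_ρ`, where `R^ν` is a rotation such that `R^ν e_d = ν`";
  "`u_ν(x) := 1` if `⟨ν, x⟩ ≥ 0`, `0` otherwise"; "`(z)⁺ := max{z, 0}`".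
* **Definition 2.1.** "Let `c_{i,j}` satisfy (H1) and (H2). We then define the homogenized surface energy
  density `φ : ℝ^d → [0,+∞)` as the convex positively homogeneous function of degree one such that for
  all `ν ∈ 𝕊^{d−1}` we have
  `φ(ν) := lim_{δ→0} lim_{S→+∞} S^{1−d} inf{E(u, Q^ν_S) : u : 𝓛 → {0,1}, u(i) = u_ν(i) on 𝓛 ∖ Q^ν_{(1−δ)S}}`."
* **Definition 2.4.** "Given `φ : ℝ^d → [0,+∞)` convex, positively homogeneous of degree one, we define
  the Wulff set of `φ` by `W_φ := {ζ ∈ ℝ^d : ⟨ζ, ν⟩ ≤ φ(ν) for all ν ∈ 𝕊^{d−1}}`.  We say that `φ` is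
  crystalline, if `W_φ` is a polytope."
* "For `k ∈ ℕ` let `Λ := Tk` and denote by `𝒜_per(Q_Λ; ℝ) := {u : 𝓛 → ℝ : u(x + Λz) = u(x) for all z ∈ ℤ^d}`
  the space of `Λ`-periodic functions."
  **Proposition 2.6.** "Let `c_{i,j} : 𝓛 × 𝓛 → [0,+∞)` be interaction coefficients such that (H1) and (H2)
  hold true. Then `φ(ν) = T^{−d} inf{E(u, Q_T) : u : 𝓛 → ℝ, u(·) − ⟨ν, ·⟩ ∈ 𝒜_per(Q_T; ℝ)}`."
* **Theorem 2.7.** "Let `c_{i,j} : 𝓛 × 𝓛 → [0,+∞)` be interaction coefficients such that (H1) and (H3)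
  hold true. Then, the homogenized surface energy density `φ` is crystalline. Denote by
  `N := #{(i,j) ∈ 𝓛 ∩ Q_T × 𝓛 : c_{i,j} ≠ 0}`. Then, `#extreme(W_φ) ≤ 3^N`."  (Example 2.8: fails without
  (H3).)
* §5, proof of Theorem 2.7, Step 1 (def:C) and (eq:dual representation): "We define
  `𝒞 = {α_{i,j} ∈ [0, c_{i,j}] : α_{i+Tz,j+Tz} = α_{i,j} for all z, Σ_{j∈𝓛}(α_{j,i} − α_{i,j}) = 0 for all
  i ∈ Q_T ∩ 𝓛}`.  Our goal is to prove
  `φ(ν) = T^{−d} sup_{(α_{i,j}) ∈ 𝒞} ⟨ν, Σ_{i ∈ 𝓛∩Q_T} Σ_{j∈𝓛} α_{i,j}(i − j)⟩`."  Step 2 (eq:Wvarphi):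
  "`W_φ = {T^{−d} Σ_{i∈𝓛∩Q_T} Σ_{j∈𝓛} α_{i,j}(i − j) : (α_{i,j}) ∈ 𝒞}`", "`W_φ = L(V ∩ Π_{(i,j)∈ℰ}[0, c_{i,j}])` …
  `W_φ` is the image of the linear map `L` … of a `N`-dimensional polytope `Π[0, c_{i,j}]` intersected
  with the linear subspace `V` … This proves that `φ` is crystalline."

## Rendering

* Dimension: `ℝ^d = EuclideanSpace ℝ (Fin (d+1))`, i.e. the file's `d : ℕ` is the printed `d − 1 ≥ 0`
  (so that the basis vector `e_d` of §2.1 is `EuclideanSpace.single (Fin.last d) 1` and `S^{1−d}`,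
  `T^{−d}` become `(S^d)⁻¹`, `(T^{d+1})⁻¹`); `ℤ^d ⊂ ℝ^d` is `intPoint`.
* A lattice system is a set `𝓛 ⊆ ℝ^d` with `IsAdmissibleLattice 𝓛 T` ((L1), (L2) with period `T ≥ 1`)
  and coefficients `c : ℝ^d → ℝ^d → ℝ` (only the values on `𝓛 × 𝓛` are used), nonnegative,
  `IsPeriodicCoeff` (H1), `HasSummableDecay` (H2), `HasFiniteRange` (H3).  Spin fields are `u : ℝ^d → ℝ`
  restricted to `𝓛`; `E(u, A)` is `energy` (a double `tsum` over `𝓛`; all statements below are made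
  under hypotheses for which the sums have finitely many nonzero terms or converge).
* The rotation `R^ν` of §2.1 ("a rotation such that `R^ν e_d = ν`", otherwise unspecified) is ANY linear
  isometry of determinant `1` with `R e_d = ν`: the facts quantify over all such `R`.
* `φ` is rendered CHOICE-FREE by the right-hand side of Proposition 2.6: `periodicCellFormula 𝓛 T c ν :=
  T^{−d} inf{E(u, Q_T) : u − ⟨ν,·⟩ is `T`-periodic on 𝓛}` (defined for every `ν ∈ ℝ^d`; it is positively
  1-homogeneous); Proposition 2.6 is then the named fact that the asymptotic formula of Definition 2.1
  converges to it — rendered as `lim_{δ→0⁺} limsup_{S→∞} = lim_{δ→0⁺} liminf_{S→∞} = periodicCellFormula`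
  (the printed iterated limit, without separately asserting that each inner limit exists).
* `W_φ` is `wulffBody φ` (Definition 2.4, any dimension; for `d + 1 = 3` it is the tree's
  `wulffSet` of `WulffCrystalEmergence.lean` — `wulffBody_eq_wulffSet`, `rfl`); "polytope" is
  `IsPolytope W := ∃ finite S, W = conv S`; `extreme(W)` is Mathlib's `Set.extremePoints ℝ W`.
* `𝒞` is `circulations 𝓛 T c` and `L` is `flux 𝓛 T` (with the factor `T^{−d}`).

## What is here

Definitions with bodies: `intPoint`, `IsAdmissibleLattice`, `IsPeriodicCoeff`, `HasSummableDecay`,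
`HasFiniteRange`, `energy`, `axisCube`, `halfspaceIndicator`, `asymptoticCellInf`, `IsLatticePeriodic`,
`periodicCellFormula`, `wulffBody`, `IsPolytope`, `edgeCount`, `circulations`, `flux`.  Proved:
`energy_nonneg`, `convex_wulffBody`, `isClosed_wulffBody`, `wulffBody_mono`, `wulffBody_eq_wulffSet`
(`d + 1 = 3`), `halfspaceIndicator_mem`.  NAMED FACTS (`def … : Prop`, never asserted):
`ChambolleKreutz2023_finiteCellFormula` (Proposition 2.6), `ChambolleKreutz2023_crystalline`
(Theorem 2.7), `ChambolleKreutz2023_dualRepresentation` ((eq:dual representation) + (eq:Wvarphi) of the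
proof of Theorem 2.7).

## What is not here

The `Γ`-convergence of the scaled energies to `∫_{∂*{u=1}} φ(ν) dH^{d−1}` (Remark 2.2, quoting
[AliCicRuf] = Alicandro–Cicalese–Ruf; for the sticky-sphere occupancies this is Cicalese–Kreutz–Leonardi
2023 Thm 5.14, typed for `L_FCC`/`L_HCP` in `WulffCrystalGammaLimit.lean`), Example 2.8 (necessity
of (H3)), Proposition 2.9 (differentiability in totally irrational directions), and the evaluation of
`W_φ` for any particular lattice (the cell's certified computations).  No instances, no notation, no
`sorry`.
-/

noncomputable section

open scoped InnerProductSpace Topology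
open Filter Set

namespace Literature.MathematicalPhysics.StatisticalMechanics.ChambolleKreutz2023

variable {d : ℕ}

/-! ### §1 Periodic lattice systems: (L1), (L2), (H1), (H2), (H3), the energy -/

/-- The point `z ∈ ℤ^d ⊂ ℝ^d`. [cite: ChambolleKreutz2023, §2.2 (L2)] -/
def intPoint (z : Fin (d + 1) → ℤ) : EuclideanSpace ℝ (Fin (d + 1)) :=
  WithLp.toLp 2 fun k => (z k : ℝ)

/-- **(L1)–(L2)**: `𝓛 ⊆ ℝ^d` is uniformly discrete and `Tℤ^d`-periodic, `T ≥ 1`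
("`𝓛 + Tz = 𝓛` for all `z ∈ ℤ^d`"; this includes Bravais lattices such as fcc and multilattices such as hcp).
[cite: ChambolleKreutz2023, §2.2 (L1)–(L2)] -/
structure IsAdmissibleLattice (𝓛 : Set (EuclideanSpace ℝ (Fin (d + 1)))) (T : ℕ) : Prop where
  discrete : ∃ c : ℝ, 0 < c ∧ ∀ x ∈ 𝓛, ∀ y ∈ 𝓛, x ≠ y → c ≤ dist x y
  pos : 0 < T
  periodic : ∀ (z : Fin (d + 1) → ℤ) (x : EuclideanSpace ℝ (Fin (d + 1))),
    x ∈ 𝓛 ↔ x + (T : ℝ) • intPoint z ∈ 𝓛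

/-- **(H1)** periodicity of the interaction coefficients: `c_{i+Tz, j+Tz} = c_{i,j}`.
[cite: ChambolleKreutz2023, §2.2 (H1)] -/
def IsPeriodicCoeff (𝓛 : Set (EuclideanSpace ℝ (Fin (d + 1))))
    (c : EuclideanSpace ℝ (Fin (d + 1)) → EuclideanSpace ℝ (Fin (d + 1)) → ℝ) (T : ℕ) : Prop :=
  ∀ (z : Fin (d + 1) → ℤ), ∀ i ∈ 𝓛, ∀ j ∈ 𝓛,
    c (i + (T : ℝ) • intPoint z) (j + (T : ℝ) • intPoint z) = c i j

/-- **(H2)** decay of interactions: `Σ_{j∈𝓛} c_{i,j}|i − j| < +∞` for every `i ∈ 𝓛`.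
[cite: ChambolleKreutz2023, §2.2 (H2)] -/
def HasSummableDecay (𝓛 : Set (EuclideanSpace ℝ (Fin (d + 1))))
    (c : EuclideanSpace ℝ (Fin (d + 1)) → EuclideanSpace ℝ (Fin (d + 1)) → ℝ) : Prop :=
  ∀ i ∈ 𝓛, Summable fun j : 𝓛 => c i j * ‖i - (j : EuclideanSpace ℝ (Fin (d + 1)))‖

/-- **(H3)** finite range: there is `R > 1` with `c_{i,j} = 0` whenever `|i − j| ≥ R`.
[cite: ChambolleKreutz2023, §2.2 (H3)] -/
def HasFiniteRange (𝓛 : Set (EuclideanSpace ℝ (Fin (d + 1))))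
    (c : EuclideanSpace ℝ (Fin (d + 1)) → EuclideanSpace ℝ (Fin (d + 1)) → ℝ) : Prop :=
  ∃ R : ℝ, 1 < R ∧ ∀ i ∈ 𝓛, ∀ j ∈ 𝓛, R ≤ dist i j → c i j = 0

/-- The localized ferromagnetic energy on the directed graph,
`E(u, A) = Σ_{i ∈ 𝓛 ∩ A} Σ_{j ∈ 𝓛} c_{i,j} (u(i) − u(j))⁺` (a spin field is a real function, used on `𝓛`).
[cite: ChambolleKreutz2023, §2.2 (the energy `E(u, A)`)] -/
def energy (𝓛 : Set (EuclideanSpace ℝ (Fin (d + 1))))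
    (c : EuclideanSpace ℝ (Fin (d + 1)) → EuclideanSpace ℝ (Fin (d + 1)) → ℝ)
    (u : EuclideanSpace ℝ (Fin (d + 1)) → ℝ) (A : Set (EuclideanSpace ℝ (Fin (d + 1)))) : ℝ :=
  ∑' i : 𝓛, A.indicator
    (fun x => ∑' j : 𝓛, c x j * (u x - u (j : EuclideanSpace ℝ (Fin (d + 1))))⁺) i

/-- The energy is nonnegative for nonnegative coefficients. [cite: ChambolleKreutz2023, §2.2] -/
theorem energy_nonneg {𝓛 : Set (EuclideanSpace ℝ (Fin (d + 1)))}
    {c : EuclideanSpace ℝ (Fin (d + 1)) → EuclideanSpace ℝ (Fin (d + 1)) → ℝ} (hc : ∀ i j, 0 ≤ c i j)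
    (u : EuclideanSpace ℝ (Fin (d + 1)) → ℝ) (A : Set (EuclideanSpace ℝ (Fin (d + 1)))) :
    0 ≤ energy 𝓛 c u A := by
  unfold energy
  refine tsum_nonneg fun i => Set.indicator_nonneg (fun x _ => ?_) _
  exact tsum_nonneg fun j => mul_nonneg (hc _ _) (posPart_nonneg _)

/-! ### §2 Cubes, the asymptotic cell formula (Definition 2.1), the finite cell formula (Prop. 2.6) -/

/-- The half-open axis cube `Q_ρ = [−ρ/2, ρ/2)^d` centred at `0`. [cite: ChambolleKreutz2023, §2.1] -/
def axisCube (ρ : ℝ) : Set (EuclideanSpace ℝ (Fin (d + 1))) :=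
  {x | ∀ k, -(ρ / 2) ≤ x k ∧ x k < ρ / 2}

/-- `u_ν(x) = 1` if `⟨ν, x⟩ ≥ 0`, `0` otherwise. [cite: ChambolleKreutz2023, §2.1 (def. of `u_ν`)] -/
def halfspaceIndicator (ν x : EuclideanSpace ℝ (Fin (d + 1))) : ℝ :=
  if 0 ≤ ⟪ν, x⟫_ℝ then 1 else 0

/-- `u_ν` takes values in `{0, 1}`. [cite: ChambolleKreutz2023, §2.1] -/
theorem halfspaceIndicator_mem (ν x : EuclideanSpace ℝ (Fin (d + 1))) :
    halfspaceIndicator ν x = 0 ∨ halfspaceIndicator ν x = 1 := by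
  unfold halfspaceIndicator
  split_ifs <;> simp

/-- The quantity inside Definition 2.1 before rescaling:
`inf{E(u, Q^ν_S) : u : 𝓛 → {0,1}, u = u_ν on 𝓛 ∖ Q^ν_{(1−δ)S}}`, with the cube `Q^ν_ρ = R Q_ρ` for a given
linear isometry `R` (the paper's `R^ν`, "a rotation such that `R^ν e_d = ν`").
[cite: ChambolleKreutz2023, Definition 2.1] -/
def asymptoticCellInf (𝓛 : Set (EuclideanSpace ℝ (Fin (d + 1))))
    (c : EuclideanSpace ℝ (Fin (d + 1)) → EuclideanSpace ℝ (Fin (d + 1)) → ℝ)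
    (ν : EuclideanSpace ℝ (Fin (d + 1)))
    (R : EuclideanSpace ℝ (Fin (d + 1)) ≃ₗᵢ[ℝ] EuclideanSpace ℝ (Fin (d + 1))) (δ S : ℝ) : ℝ :=
  sInf {e | ∃ u : EuclideanSpace ℝ (Fin (d + 1)) → ℝ, (∀ x ∈ 𝓛, u x = 0 ∨ u x = 1) ∧
    (∀ x ∈ 𝓛, x ∉ R '' axisCube ((1 - δ) * S) → u x = halfspaceIndicator ν x) ∧
      e = energy 𝓛 c u (R '' axisCube S)}

/-- `v` is `Tℤ^d`-periodic on `𝓛`: `v(x + Tz) = v(x)` ("`𝒜_per(Q_T; ℝ)`").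
[cite: ChambolleKreutz2023, §2.3 (def. of `𝒜_per`)] -/
def IsLatticePeriodic (𝓛 : Set (EuclideanSpace ℝ (Fin (d + 1)))) (T : ℕ)
    (v : EuclideanSpace ℝ (Fin (d + 1)) → ℝ) : Prop :=
  ∀ (z : Fin (d + 1) → ℤ), ∀ x ∈ 𝓛, v (x + (T : ℝ) • intPoint z) = v x

/-- **The finite (periodic) cell formula** — the right-hand side of Proposition 2.6, used here as the
DEFINITION of the density `φ`:
`φ(ν) = T^{−d} inf{E(u, Q_T) : u : 𝓛 → ℝ, u − ⟨ν, ·⟩ ∈ 𝒜_per(Q_T; ℝ)}` (for every `ν ∈ ℝ^d`).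
[cite: ChambolleKreutz2023, Proposition 2.6] -/
def periodicCellFormula (𝓛 : Set (EuclideanSpace ℝ (Fin (d + 1)))) (T : ℕ)
    (c : EuclideanSpace ℝ (Fin (d + 1)) → EuclideanSpace ℝ (Fin (d + 1)) → ℝ)
    (ν : EuclideanSpace ℝ (Fin (d + 1))) : ℝ :=
  ((T : ℝ) ^ (d + 1))⁻¹ *
    sInf {e | ∃ u : EuclideanSpace ℝ (Fin (d + 1)) → ℝ,
      IsLatticePeriodic 𝓛 T (fun x => u x - ⟪ν, x⟫_ℝ) ∧ e = energy 𝓛 c u (axisCube T)}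

/-! ### §3 Wulff sets, polytopes (Definition 2.4); circulations and fluxes (§5) -/

/-- The Wulff set `W_φ = {ζ : ⟨ζ, ν⟩ ≤ φ(ν) for all ν ∈ 𝕊^{d−1}}` (any dimension).
[cite: ChambolleKreutz2023, Definition 2.4] -/
def wulffBody {V : Type*} [NormedAddCommGroup V] [InnerProductSpace ℝ V] (φ : V → ℝ) : Set V :=
  {ζ | ∀ ν : V, ‖ν‖ = 1 → ⟪ζ, ν⟫_ℝ ≤ φ ν}

/-- The Wulff set is convex (an intersection of closed half-spaces). [cite: ChambolleKreutz2023, Definition 2.4 and §5 Step 2 ("closed and convex")] -/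
theorem convex_wulffBody {V : Type*} [NormedAddCommGroup V] [InnerProductSpace ℝ V] (φ : V → ℝ) :
    Convex ℝ (wulffBody φ) := by
  intro x hx y hy a b ha hb hab ν hν
  have h1 := hx ν hν
  have h2 := hy ν hν
  rw [inner_add_left, real_inner_smul_left, real_inner_smul_left]
  calc a * ⟪x, ν⟫_ℝ + b * ⟪y, ν⟫_ℝ ≤ a * φ ν + b * φ ν := by gcongr
    _ = φ ν := by rw [← add_mul, hab, one_mul]

/-- The Wulff set is closed. [cite: ChambolleKreutz2023, Definition 2.4 and §5 Step 2 ("closed and convex")] -/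
theorem isClosed_wulffBody {V : Type*} [NormedAddCommGroup V] [InnerProductSpace ℝ V] (φ : V → ℝ) :
    IsClosed (wulffBody φ) := by
  have : wulffBody φ = ⋂ ν ∈ {ν : V | ‖ν‖ = 1}, {ζ : V | ⟪ζ, ν⟫_ℝ ≤ φ ν} := by
    ext ζ; simp [wulffBody]
  rw [this]
  exact isClosed_biInter fun ν _ =>
    isClosed_le (continuous_id.inner continuous_const) continuous_const

/-- The Wulff set is monotone in the density. [cite: ChambolleKreutz2023, Definition 2.4] -/
theorem wulffBody_mono {V : Type*} [NormedAddCommGroup V] [InnerProductSpace ℝ V] {φ ψ : V → ℝ}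
    (h : ∀ ν, ‖ν‖ = 1 → φ ν ≤ ψ ν) : wulffBody φ ⊆ wulffBody ψ :=
  fun _ hζ ν hν => (hζ ν hν).trans (h ν hν)

/-- In `ℝ³` this is the tree's `wulffSet` (Cicalese–Kreutz–Leonardi (22)), definitionally.
[cite: ChambolleKreutz2023, Definition 2.4] -/
theorem wulffBody_eq_wulffSet (φ : EuclideanSpace ℝ (Fin 3) → ℝ) : wulffBody φ = wulffSet φ := rfl

/-- A polytope: the convex hull of finitely many points ("we say that `φ` is crystalline, if `W_φ` is a
polytope"). [cite: ChambolleKreutz2023, Definition 2.4] -/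
def IsPolytope {V : Type*} [AddCommGroup V] [Module ℝ V] (W : Set V) : Prop :=
  ∃ S : Finset V, W = convexHull ℝ (↑S : Set V)

/-- `N = #{(i,j) ∈ (𝓛 ∩ Q_T) × 𝓛 : c_{i,j} ≠ 0}`, the number of bonds issuing from one period cell
(`Set.ncard`; finite under (L1) and (H3)). [cite: ChambolleKreutz2023, Theorem 2.7 (def. of `N`)] -/
def edgeCount (𝓛 : Set (EuclideanSpace ℝ (Fin (d + 1)))) (T : ℕ)
    (c : EuclideanSpace ℝ (Fin (d + 1)) → EuclideanSpace ℝ (Fin (d + 1)) → ℝ) : ℕ :=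
  Set.ncard {p : EuclideanSpace ℝ (Fin (d + 1)) × EuclideanSpace ℝ (Fin (d + 1)) |
    p.1 ∈ 𝓛 ∩ axisCube T ∧ p.2 ∈ 𝓛 ∧ c p.1 p.2 ≠ 0}

/-- The periodic circulations (def:C):
`𝒞 = {α_{i,j} ∈ [0, c_{i,j}] : α_{i+Tz,j+Tz} = α_{i,j}, Σ_{j∈𝓛}(α_{j,i} − α_{i,j}) = 0 for all i ∈ Q_T ∩ 𝓛}`
(divergence-free periodic flows on the bond graph bounded by the capacities `c`).
[cite: ChambolleKreutz2023, §5, proof of Theorem 2.7, Step 1 (def:C)] -/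
def circulations (𝓛 : Set (EuclideanSpace ℝ (Fin (d + 1)))) (T : ℕ)
    (c : EuclideanSpace ℝ (Fin (d + 1)) → EuclideanSpace ℝ (Fin (d + 1)) → ℝ) :
    Set (EuclideanSpace ℝ (Fin (d + 1)) → EuclideanSpace ℝ (Fin (d + 1)) → ℝ) :=
  {α | (∀ i ∈ 𝓛, ∀ j ∈ 𝓛, 0 ≤ α i j ∧ α i j ≤ c i j) ∧ IsPeriodicCoeff 𝓛 α T ∧
    ∀ i ∈ 𝓛 ∩ axisCube T,
      ∑' j : 𝓛, (α (j : EuclideanSpace ℝ (Fin (d + 1))) i - α i j) = 0}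

/-- The flux (def:L) of a bond field, `L(α) = T^{−d} Σ_{i ∈ 𝓛∩Q_T} Σ_{j∈𝓛} α_{i,j}(i − j)`.
[cite: ChambolleKreutz2023, §5, proof of Theorem 2.7, Step 2 (def:L)] -/
def flux (𝓛 : Set (EuclideanSpace ℝ (Fin (d + 1)))) (T : ℕ)
    (α : EuclideanSpace ℝ (Fin (d + 1)) → EuclideanSpace ℝ (Fin (d + 1)) → ℝ) :
    EuclideanSpace ℝ (Fin (d + 1)) :=
  ((T : ℝ) ^ (d + 1))⁻¹ •
    ∑' i : ↥(𝓛 ∩ axisCube (T : ℝ)), ∑' j : 𝓛,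
      α i j • ((i : EuclideanSpace ℝ (Fin (d + 1))) - (j : EuclideanSpace ℝ (Fin (d + 1))))

/-! ### §4 The named facts -/

/-- **Chambolle–Kreutz 2023, Proposition 2.6 (finite cell formula), NAMED FACT.**  For an admissible
periodic lattice `𝓛` ((L1)–(L2), period `T`) and nonnegative coefficients with (H1) and (H2), the
asymptotic cell formula of Definition 2.1 equals the one-period formula: for every `ν ∈ 𝕊^{d−1}` and every
rotation `R` with `R e_d = ν`,
`lim_{δ→0} lim_{S→∞} S^{1−d} inf{E(u, Q^ν_S) : u : 𝓛 → {0,1}, u = u_ν off Q^ν_{(1−δ)S}} = T^{−d} inf{E(u, Q_T) :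
u − ⟨ν,·⟩ ∈ 𝒜_per(Q_T; ℝ)}` — rendered with `limsup_S` and `liminf_S` both converging, as `δ → 0⁺`, to
`periodicCellFormula 𝓛 T c ν`. [cite: ChambolleKreutz2023, Proposition 2.6; Definition 2.1] -/
def ChambolleKreutz2023_finiteCellFormula : Prop :=
  ∀ (d : ℕ) (𝓛 : Set (EuclideanSpace ℝ (Fin (d + 1)))) (T : ℕ)
    (c : EuclideanSpace ℝ (Fin (d + 1)) → EuclideanSpace ℝ (Fin (d + 1)) → ℝ),
    IsAdmissibleLattice 𝓛 T → (∀ i j, 0 ≤ c i j) → IsPeriodicCoeff 𝓛 c T → HasSummableDecay 𝓛 c →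
    ∀ (ν : EuclideanSpace ℝ (Fin (d + 1))), ‖ν‖ = 1 →
    ∀ (R : EuclideanSpace ℝ (Fin (d + 1)) ≃ₗᵢ[ℝ] EuclideanSpace ℝ (Fin (d + 1))),
      LinearMap.det (R.toLinearEquiv : EuclideanSpace ℝ (Fin (d + 1)) →ₗ[ℝ] EuclideanSpace ℝ (Fin (d + 1))) = 1 →
      R (EuclideanSpace.single (Fin.last d) (1 : ℝ)) = ν →
        Tendsto (fun δ : ℝ => limsup (fun S : ℝ => (S ^ d)⁻¹ * asymptoticCellInf 𝓛 c ν R δ S) atTop)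
            (𝓝[>] (0 : ℝ)) (𝓝 (periodicCellFormula 𝓛 T c ν)) ∧
          Tendsto (fun δ : ℝ => liminf (fun S : ℝ => (S ^ d)⁻¹ * asymptoticCellInf 𝓛 c ν R δ S) atTop)
            (𝓝[>] (0 : ℝ)) (𝓝 (periodicCellFormula 𝓛 T c ν))

/-- **Chambolle–Kreutz 2023, Theorem 2.7 (crystallinity), NAMED FACT.**  For an admissible periodic
lattice and nonnegative coefficients with (H1) and (H3) (finite range), the homogenized density
(= `periodicCellFormula`, Proposition 2.6) is crystalline: its Wulff set is a polytope, with at most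
`3^N` extreme points, `N = #{(i,j) ∈ (𝓛∩Q_T) × 𝓛 : c_{i,j} ≠ 0}`.
[cite: ChambolleKreutz2023, Theorem 2.7; Definition 2.4] -/
def ChambolleKreutz2023_crystalline : Prop :=
  ∀ (d : ℕ) (𝓛 : Set (EuclideanSpace ℝ (Fin (d + 1)))) (T : ℕ)
    (c : EuclideanSpace ℝ (Fin (d + 1)) → EuclideanSpace ℝ (Fin (d + 1)) → ℝ),
    IsAdmissibleLattice 𝓛 T → (∀ i j, 0 ≤ c i j) → IsPeriodicCoeff 𝓛 c T → HasFiniteRange 𝓛 c →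
      IsPolytope (wulffBody (periodicCellFormula 𝓛 T c)) ∧
        (Set.extremePoints ℝ (wulffBody (periodicCellFormula 𝓛 T c))).Finite ∧
        (Set.extremePoints ℝ (wulffBody (periodicCellFormula 𝓛 T c))).ncard ≤ 3 ^ edgeCount 𝓛 T c

/-- **Chambolle–Kreutz 2023, proof of Theorem 2.7, Steps 1–2 (dual representation; the Wulff set is the
image of the periodic circulation polytope), NAMED FACT.**  Under (L1)–(L2), (H1), (H3) and `c ≥ 0`:
`φ(ν) = T^{−d} sup_{α ∈ 𝒞} ⟨ν, Σ_{i∈𝓛∩Q_T}Σ_{j∈𝓛} α_{i,j}(i − j)⟩` for every `ν ∈ ℝ^d`, and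
`W_φ = {T^{−d} Σ_{i∈𝓛∩Q_T}Σ_{j∈𝓛} α_{i,j}(i − j) : α ∈ 𝒞} = L(𝒞)` (max-flow/min-cut duality made into a
statement about `W_φ`). [cite: ChambolleKreutz2023, §5, proof of Theorem 2.7: (def:C), (eq:dual representation), (eq:Wvarphi)] -/
def ChambolleKreutz2023_dualRepresentation : Prop :=
  ∀ (d : ℕ) (𝓛 : Set (EuclideanSpace ℝ (Fin (d + 1)))) (T : ℕ)
    (c : EuclideanSpace ℝ (Fin (d + 1)) → EuclideanSpace ℝ (Fin (d + 1)) → ℝ),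
    IsAdmissibleLattice 𝓛 T → (∀ i j, 0 ≤ c i j) → IsPeriodicCoeff 𝓛 c T → HasFiniteRange 𝓛 c →
      (∀ ν : EuclideanSpace ℝ (Fin (d + 1)),
        periodicCellFormula 𝓛 T c ν =
          sSup ((fun α => ⟪ν, flux 𝓛 T α⟫_ℝ) '' circulations 𝓛 T c)) ∧
      wulffBody (periodicCellFormula 𝓛 T c) = flux 𝓛 T '' circulations 𝓛 T c

/-! ### §5 A consequence in the consumed form (PROVED from the named facts) -/

/-- From the dual representation: every periodic circulation `α ∈ 𝒞` gives a point `L(α)` of the Wulff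
set, i.e. a LOWER bound `⟨ν, L(α)⟩ ≤ φ(ν)` for all unit `ν` — the calibration principle by which explicit
flows certify lower bounds on the homogenized density (and on `|W_φ|`).
[cite: ChambolleKreutz2023, §5, proof of Theorem 2.7 (eq:Wvarphi)] -/
theorem inner_flux_le_of_mem_circulations (h : ChambolleKreutz2023_dualRepresentation) {d : ℕ}
    {𝓛 : Set (EuclideanSpace ℝ (Fin (d + 1)))} {T : ℕ}
    {c : EuclideanSpace ℝ (Fin (d + 1)) → EuclideanSpace ℝ (Fin (d + 1)) → ℝ}
    (h𝓛 : IsAdmissibleLattice 𝓛 T) (hc : ∀ i j, 0 ≤ c i j) (hper : IsPeriodicCoeff 𝓛 c T)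
    (hfin : HasFiniteRange 𝓛 c) {α : EuclideanSpace ℝ (Fin (d + 1)) → EuclideanSpace ℝ (Fin (d + 1)) → ℝ}
    (hα : α ∈ circulations 𝓛 T c) {ν : EuclideanSpace ℝ (Fin (d + 1))} (hν : ‖ν‖ = 1) :
    ⟪flux 𝓛 T α, ν⟫_ℝ ≤ periodicCellFormula 𝓛 T c ν := by
  have hW := (h d 𝓛 T c h𝓛 hc hper hfin).2
  have hmem : flux 𝓛 T α ∈ wulffBody (periodicCellFormula 𝓛 T c) := by
    rw [hW]; exact ⟨α, hα, rfl⟩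
  exact hmem ν hν

end Literature.MathematicalPhysics.StatisticalMechanics.ChambolleKreutz2023

end
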